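import Literature.MathematicalPhysics.QuantumFieldTheory.Balaban1983to89.B8Eq178Averages
import Literature.MathematicalPhysics.QuantumFieldTheory.Balaban1983to89.B8Eq138LandauZd
import Literature.MathematicalPhysics.QuantumFieldTheory.Balaban1983to89.B7Prop8to10Local
import Literature.MathematicalPhysics.QuantumFieldTheory.Balaban1983to89.B8ScaledSupNorm

/-!
# `Balaban1983to89.B8Prop5LandauDataZd` — [Balaban1985RegularSpaces] Proposition 5 (p. 94) AT OBJECTS: the concrete
# `B8.LandauData` member `zdLan` of the general-background `ℤᵈ × 𝔸` family (the carrier the abstract leaf conjuncts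
# `B8.Prop5Exists B₀′ B₁ lan` ∕ `B8.Prop5Unique lan` are pinned to)

statement-level skeleton of published theorems with citation tags; proofs where landed; nothing here is a claim about the
Yang–Mills mass gap

CITATION HEADER (cell `lit-balaban`, R141 (B) typer seat `lit-balaban-type-B8`; rows of `HOME/SKELETON.md` block B8:
B8.Prop5 (owner r05), with B8.Eq1.69, B8.Eq1.72, B8.Eq1.77, B8.Eq1.106 entering as hypotheses ∕ norms BY NAME; free targets,
zero head weight).  T. Bałaban, *Spaces of regular gauge field configurations on a lattice and gauge fixing conditions*,
Commun. Math. Phys. **99** (1985) 75–102 `[Balaban1985RegularSpaces]` ("B8"; journal page = PDF page + 74), held text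
`paper:balaban1985-cmp99-regular-spaces-gauge-fixing` pp. 88–89 [PDF 14–15], 93–95 [PDF 19–21]:

> p. 94 [PDF 20]: «**Proposition 5.** There exist positive constants c₂, c₃, depending on d and L only, such that for an
> arbitrary configuration U₁ satisfying (1.69), and for the configuration u₁ determined by U₁ and satisfying (1.68),
> (1.73), (1.74), if α₀ + α₁ ≦ c₂, then there exists a configuration u′ = e^{iλ} satisfying the equations
> R D*(1∕iη) log U₁^{u′⁻¹} = 0,  R₀\overline{u′u₁}ʲ = 1 on Λ_j, j = 0, 1, …, k  (1.107)
> and the bounds |λ|, |Dλ|₍₋₁₎ < 8B′₀B₁(α₀ + α₁).  (1.108)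
> Such a configuration u′ is unique in the domain |λ|, |Dλ|₍₋₁₎ < c₃.  (1.109)»

with its standing context p. 88 [PDF 14] «Let us take configurations U₀, U′U₀ satisfying the conditions (1.33), (1.34), (1.66)»,
p. 89 [PDF 15] «We fix a configuration U₀ and we omit it in formulas below, for example we write D instead of D^η_{U₀}»,
«We will use only the properties (1.69), (1.73), (1.74) of the configurations u₁, U₁ in the future.  They are satisfied in
the case k = 1 also, if we take u₁ = 1, U′ = U₁», «(we take Λ_{k−1} ∪ B(Λ_k) as Λ_{k−1})», p. 93 [PDF 19] (1.102)
«{λ : |λ| < βα₄, |Dλ| < βα₄(Lʲη)⁻¹ on Ω_j, j = 0, 1, …, k − 1}, or simply {λ : |λ|, |Dλ|₍₋₁₎ < βα₄}», and p. 95 [PDF 21]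
«In the considered case a configuration identically equal to 1 is a solution also».

WHY THIS FILE.  The r1 leaf conjuncts p5e ∕ p5u of the N05 knit (`B8LeafKnitZd3B9All.b8LeafRS_zd3_univ_b9all`,
`Node00.CarriersB8.b8LeafOfRecord_of_knit`) are `B8.Prop5Exists B₀′ B₁ lan` ∕ `B8.Prop5Unique lan` over an ABSTRACT family
`lan : I → B8.LandauData` — and the tree held NO instance of `B8.LandauData` (`Node00/CarriersB8.lean` header: «Proposition 5's
carriers `lan` (the space R(U₀) and the Landau-gauge equations (1.105)–(1.109)) are not objects of the tree»; the record's
`ResidB8.lan` is residual data, pinnable only vacuously at `I8c := PEmpty`).  This file TYPES THE MEMBER: for a geometric datum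
`i : ZdLanIdx d 𝔸` (spacing `η > 0`, `k ≥ 1` levels, the domain sequence `Ω_j` and the constraint sets `Λ_j` of the level-`k`
problem in level-`j` coordinates, and the FIXED unitary background `U₀` of Sects. C–D) and the constant `B₁` of Theorems 2 ∕ 4,
**`zdLan L B₁ i : B8.LandauData`** reads, field by field and BY NAME over the lineage's typed displays,
* `Cfg` := Proposition 5's datum «U₁ = e^{iηA} and the configuration u₁»: pairs `(u₁, A)`, `u₁ : ℤᵈ → U(𝔸)` a unitary-valued
  gauge transformation, `A` a Hermitian (`𝔤`-valued) bond field, `U₁ := e^{iηA}` = `B8Eq184Proof.cfgExp η A`;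
* `Hyp169 α₀ α₁ (u₁, A)` := the standing hypothesis (1.33) «U₀ ∈ 𝔄_k({Ω_j}, α₀)» (`B8Ineq132.InAk`) ∧ **(1.69)** for `A` with
  the constant `B₁(α₀ + α₁)` (`B8Eq178Averages.Cond169`, r05 — «|A| < B₁(α₀+α₁)(Lʲη)⁻¹, |∇^η_{U₀}A| < B₁(α₀+α₁)(Lʲη)⁻² on
  Ω_j, j = 0, 1, …, k − 1») ∧ **(1.68)** for `u₁` (`B8Eq178Averages.Cond168`, r05 — «(R₀\overline{u₁}ʲ)(y) = 1 for y ∈ Λ_j,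
  j ≦ k − 2, and for y ∈ Λ_{k−1} ∪ B(Λ_k)») ∧ **(1.73)–(1.74)** for `u₁` (`Cond7374` below = «|(R₀\overline{u₁}ⁿ)(x_n) − 1| <
  16dB₁(α₀+α₁)» and «|(R₀\overline{u₁}ⁿ)⁻¹(x_{n+1})(R̄ⁿ_{0,x_{n+1}}R₀\overline{u₁}ⁿ)(x_n) − 1| < 4dB₁(α₀+α₁)L^{n+1−j}, x_n ∈ B(x_{n+1}),
  x_{n+1} ∈ B^{j−n−1}(Λ_j), n = 0, …, j − 1, j = 1, …, k − 1» on the towers `Bʲ(y)`, stated through r07's box-local [3]-(166)∕(167)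
  predicates `B7Prop8to10Local.Cond166On` ∕ `Cond167On` on the lattice `T_{L^{−j}}` — p. 89: «(1.73), (1.74) together with the
  condition R₀\overline{u₁}ʲ = 1 on Λ_j imply that u₁ satisfies (166), (167) [3] on Bʲ(Λ_j) ⊂ T_{L^{−j}}»);
* `Lam` := the gauge parameters `λ` of `u′ = e^{iλ}` (`B8Eq184Proof.gaugeExp`): Hermitian site functions, `= 0` off `Ω₀` (the
  carrier convention of the family of record `B8LeafModelZd.zdGF`, hazard №3: gauge transformations are carried by `Ω₀`), and
  BOUNDED together with `D_{U₀}λ` (the `ℤᵈ` side condition under which print's finite-lattice suprema are the real `iSup` of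
  `B8ScaledSupNorm`, its HONEST SCOPE);
* `lamNorm λ` := `max(|λ|, |Dλ|₍₋₁₎)` of (1.102)∕(1.108)∕(1.109) = `max (siteNorm L (k−1) η 0 Ω λ) (bondNorm L (k−1) η (−1) Ω (D_{U₀}λ))`
  (`B8ScaledSupNorm`, p. 86 «|A|_(α) = sup_j sup_{Ω_j} (Lʲη)^{−α}|A|», levels `j ≦ k − 1` as displayed in (1.102), `D = D^η_{U₀}` the
  forward covariant derivative (1.1) `B8Ineq132.covDerivFwd`);
* `Solves (u₁, A) λ` := **(1.107)**: «R D*(1∕iη) log U₁^{u′⁻¹} = 0» as the lineage's (1.38)-for-a-configuration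
  `B8Eq138LandauZd.IsLandau138W L k η Ω₀ Λ U₀ (U₁^{u′⁻¹})` with `U₁^{u′⁻¹} = mgauge U₀ (e^{iλ})⁻¹ (e^{iηA})` (the moving-frame action
  (1.17), `B7Eq92Concrete.mgauge`) ∧ «R₀\overline{u′u₁}ʲ = 1 on Λ_j, j ≦ k» as `B8Eq119TwistedAxial.Restr129 L k Λ U₀ (u₁·e^{iλ})` — the
  SAME two letters the Prop.-5 sockets `B8LeafModelZdOfHFP.SockHFP` ∕ `B8LeafModelZd.SockP5u` conclude with.
So `B8.Prop5Exists B₀′ B₁ (zdLan L B₁)` ∕ `B8.Prop5Unique (zdLan L B₁)` ARE Proposition 5 as printed at these objects (displayed in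
tree vocabulary: `prop5Exists_zdLan_iff` ∕ `prop5Unique_zdLan_iff`); no new `…Printed` fact is minted.

WHAT IS TYPED ∕ PROVED.  §1 `Cond7374` ((1.73)–(1.74), definition).  §2 `ZdLanIdx`, **`zdLan`** (definitions), the field readings
`zdLan_hyp169_iff` ∕ `zdLan_solves_iff` ∕ `zdLan_lamNorm_eq` (`Iff.rfl` ∕ `rfl`).  §3 kernel API: `cond7374_one` + `cond168_one'` +
**`hyp169_one`** (p. 89 «They are satisfied in the case k = 1 also, if we take u₁ = 1»: for the datum `(1, A)` the hypothesis is
(1.33) ∧ (1.69) alone); `covDerivFwd_zero_fun`, `lamZero` (the parameter `λ = 0` as an element of `Lam`), `gaugeExp_zero'`,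
`mgauge_one_mid`, **`solves_lamZero_iff`** (p. 95 «a configuration identically equal to 1 is a solution also»: `λ = 0` solves (1.107)
iff `U₁` is already in the Landau gauge (1.38) and `u₁` is (1.29)-restricted); `lamNorm_lamZero`; `bdd_of_lam` (the member's parameters
are bounded families for the p. 86 suprema); the dictionary **`norm_lt_of_lamNorm_lt`** ((1.108)∕(1.109) ⇒ print's pointwise form «|λ| < c, |Dλ| < c(Lʲη)⁻¹ on Ω_j, j ≦ k − 1»),
**`lamNorm_lt_of_pointwise`** (converse, from non-strict pointwise bounds by a smaller constant), `cond177_of_lamNorm_lt` (a `λ` in the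
ball (1.109) lies in r05's typed domain (1.77) `B8Eq178Averages.Cond177` with `α₄ = c`); §4 the displays `prop5Exists_zdLan_iff`,
`prop5Unique_zdLan_iff`.

READINGS ∕ HONEST SCOPE.  (a) `U₀` is part of the INDEX (print fixes it; `lamNorm` needs `D = D^η_{U₀}` and `B8.LandauData.lamNorm`
has no configuration argument); (1.33) for `U₀` at `α₀` is the first clause of `Hyp169` (the proposition is asserted inside the proof
of Theorem 4 under (1.33); without it the member would claim Prop. 5 at irregular backgrounds).  (b) `B₁` is a PARAMETER of the member
((1.69), (1.73), (1.74) carry it); the knit instantiates `B8.Prop5Exists B₀′ B₁ (zdLan L B₁)` with the same letter.  (c) (1.73)–(1.74)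
are typed in their tower-local (166)∕(167) form with print's two constants `16dB₁(α₀+α₁)` ∕ `4dB₁(α₀+α₁)` and `η_j = L^{−j}`, levels
`1 ≦ j ≦ k − 1` (the range displayed in (1.74)); the `j = 0` towers are single sites where (1.68) already gives `u₁ = 1`.  (d) The
composite `u = u′u₁` of p. 89 is the lineage's pointwise product `u₁ * e^{iλ}` (`SockHFP`∕`SockP5u`: `Restr129 … (u₁ * v)`,
`mgauge U₀ v⁻¹ U₁`).  (e) `≦`∕`<` as in the cited predicates (r05's `Cond169` strict, r07's `Cond166On` non-strict); (1.108)∕(1.109)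
strict as printed.  (f) Nothing of Proposition 5 is asserted or proved here: the member is a DEFINITION; its p5e∕p5u instances are
the open printed statements (providers: the Sect. D∕E lineage `B8Prop5JoinSectELocal.hFP_kLevel_of_sectE_local'`, `B8SockHFPAssembly`,
`B8Prop5UniqKLevel` work with Theorem 4's datum `(U′, u₁)`; the bridge from print's datum `((1.69), (1.68), (1.73), (1.74))` is [3]
Prop. 10 for `u₁ ∈ Λ(U₀, α₃)`, `B7Eq214General.eq214_general_of207`, not done here).  Count-neutral; N05 NOT discharged; one finite
lattice programme — nothing continuum ∕ ℝ⁴ ∕ OS ∕ mass-gap ∕ Clay.  No `sorry`, no `axiom`, no `instance`, no `notation`.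
Unit `lit-balaban-type-B8` (g0), 2026-08-26.
-/

noncomputable section

open NormedSpace

namespace Literature.MathematicalPhysics.QuantumFieldTheory.Balaban1983to89.B8Prop5LandauDataZd

open Complex (I)
open B7Prop1Explicit B7Prop2Explicit B7Eq92Concrete
open B7Prop1Local (InBox)
open B8Ineq130 (tlo thi)
open B8Ineq132 (covDerivFwd InAk BondTouches)
open B8Eq119TwistedAxial (Restr129 bgT)
open B8Eq184Proof (gaugeExp cfgExp)
open B8Eq138LandauZd (IsLandau138W)
open B8Eq178Averages (Cond168 Cond169 Cond177)
open B7Prop8to10Local (Cond166On Cond167On BlockIn)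
open B8ScaledSupNorm (siteNorm bondNorm msup weight Bdd)
open B7Eq78Linearization (Rbar zdBlocking)
open Literature.MathematicalPhysics.QuantumLattice (blockSites)

-- `Site` alone could resolve to the torus sites of `Setup.lean`; re-export the `ℤ^d` sites of `B7Prop1Explicit`.
export B7Prop1Explicit (Site)

variable {d : ℕ}

/-! ## §1 (1.73)–(1.74): the regularity of the inductive gauge transformation `u₁` on the towers `Bʲ(Λ_j)` -/

section Cond7374

variable {𝔸 : Type*} [NormedRing 𝔸] [NormedAlgebra ℂ 𝔸] [CompleteSpace 𝔸]

/-- **(1.73)–(1.74) TYPED** (pp. 88–89 [PDF 14–15]): for the inductive gauge transformation `u₁` of step `k − 1`,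
«|(R₀\overline{u₁}ⁿ)(x_n) − 1| < 16dB₁(α₀ + α₁)» (1.73) and «|(R₀\overline{u₁}ⁿ)⁻¹(x_{n+1})(R̄ⁿ_{0,x_{n+1}}R₀\overline{u₁}ⁿ)(x_n) − 1| <
4dB₁(α₀ + α₁)L^{n+1}L^{−j} for x_n ∈ B(x_{n+1}), x_{n+1} ∈ B^{j−n−1}(Λ_j), n = 0, …, j − 1, j = 1, …, k − 1 (we take Λ_{k−1} ∪ B(Λ_k) as
Λ_{k−1})» (1.74) — read, as p. 89 reads them («(1.73), (1.74) together with the condition R₀\overline{u₁}ʲ = 1 on Λ_j imply that u₁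
satisfies (166), (167) [3] on Bʲ(Λ_j) ⊂ T_{L^{−j}}»), through r07's box-local predicates `B7Prop8to10Local.Cond166On` (the averages
`(\overline{R₀u₁})ⁿ(x_n)`, `n ≦ j`, on the blocks inside the tower `Bʲ(y) = [tlo L y j, thi L y j]`, within `a` of `1`) and `Cond167On` (the
one-step expressions of (167), `n < j`, bounded by `b·L^{n+1}·L^{−j}`), for every tower base `y ∈ Λ_j`, `1 ≦ j ≦ k − 2`, and
`y ∈ Λ_{k−1} ∪ B(Λ_k)` at `j = k − 1` (`B(Λ_k)` = the level-`(k−1)` blocks `QuantumLattice.blockSites L z`, `z ∈ Λ_k`, as in r05's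
`B8Eq178Averages.Cond168`); print's constants are `a = 16dB₁(α₀ + α₁)`, `b = 4dB₁(α₀ + α₁)` (`zdLan` below).  Written with `j + 1 ≦ k`
∕ `j + 1 = k` so that no subtraction occurs.  Abstract slot form of the same displays: `B8Ineq170.Concl7374`.
ERRATUM ∕ READING (v1.1, referee lit-balaban-ref-2 g138 GAP-STATED(135), PNG p014–p015 read): two points in which this typed form is
WEAKER than the printed hypothesis (so that the typed Proposition 5, which assumes it, is at least the printed statement — p. 89 uses only
the tower-local (166)∕(167) form: «thus … the assumptions of Proposition 10 are satisfied»): (i) r07's `Cond166On` ∕ `Cond167On` carry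
NON-STRICT bounds `≤ a`, `≤ b·L^{n+1}·L^{−j}`, while (1.73) ∕ (1.74) print STRICT `<`; (ii) print displays (1.73) for ALL `x_n ∈ Ω₀^{(n)}`
(«|(R₀\overline{u₁}ⁿ)(x_n) − 1| < 16dB₁(α₀ + α₁), x_n ∈ Ω₀^{(n)}», p. 88), whereas here it is asked only on the blocks inside the towers
`Bʲ(y)` over `Λ_j` (and `Λ_{k−1} ∪ B(Λ_k)`); (1.74) is printed on `B^{j−n−1}(Λ_j)`, i.e. tower-locally, as typed.
[cite: Balaban1985RegularSpaces, (1.73)–(1.74) pp.88–89; Balaban1985Averaging, (166)–(167) p.44] -/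
def Cond7374 (L k : ℕ) (Λ : ℕ → Set (Site d)) (U₀ : Site d → Fin d → 𝔸ˣ) (u₁ : Site d → 𝔸ˣ) (a b : ℝ) : Prop :=
  ∀ (j : ℕ) (y : Site d), 1 ≤ j →
    (j + 1 ≤ k ∧ y ∈ Λ j) ∨ (j + 1 = k ∧ ∃ z ∈ Λ k, y ∈ blockSites L z) →
      Cond166On L (tlo L y j) (thi L y j) U₀ u₁ j a ∧ Cond167On L (tlo L y j) (thi L y j) U₀ u₁ j b (((L : ℝ) ^ j)⁻¹)

/-- (1.73)–(1.74) hold for `u₁ = 1` (all its averages are `1`, `B7Eq167Flat.uavg_one_right` ∕ `inLambda_one`) whenever the two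
constants are non-negative — half of p. 89's «They are satisfied in the case k = 1 also, if we take u₁ = 1».
[cite: Balaban1985RegularSpaces, p.89 (sentence after (1.74))] -/
theorem cond7374_one (L k : ℕ) (Λ : ℕ → Set (Site d)) (U₀ : Site d → Fin d → 𝔸ˣ) {a b : ℝ} (ha : 0 ≤ a) (hb : 0 ≤ b) :
    Cond7374 L k Λ U₀ (1 : Site d → 𝔸ˣ) a b := by
  intro j y _ _
  have hηj : (0 : ℝ) ≤ ((L : ℝ) ^ j)⁻¹ := by positivity
  obtain ⟨h166, -⟩ := B7Eq167Flat.inLambda_one L U₀ j ha hηj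
  obtain ⟨-, h167⟩ := B7Eq167Flat.inLambda_one L U₀ j hb hηj
  exact ⟨fun n hn w _ => h166 n hn w, fun n hn w r _ => h167 n hn w r⟩

/-- (1.68) holds for `u₁ = 1` (the other half of p. 89's sentence; all averages `R̄₀1ʲ = 1`, by the bridge
`B8Eq178Averages.rbar_bgT_eq_uavg` to `B7Eq167Flat.uavg_one_right`; cf. `B8Thm4TruncationLocal.cond168_one`, not imported here).
[cite: Balaban1985RegularSpaces, p.89 (sentence after (1.74)), (1.68) p.88] -/
theorem cond168_one' (L k : ℕ) (Λ : ℕ → Set (Site d)) (U₀ : Site d → Fin d → 𝔸ˣ) :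
    Cond168 L k Λ U₀ (1 : Site d → 𝔸ˣ) := by
  have h1 : ∀ (j : ℕ) (y : Site d),
      Rbar (zdBlocking d L) (bgT L U₀) j (fun x => (((1 : Site d → 𝔸ˣ) x : 𝔸ˣ) : 𝔸)) y = 1 := by
    intro j y
    rw [B8Eq178Averages.rbar_bgT_eq_uavg L U₀ (1 : Site d → 𝔸ˣ) j, B7Eq167Flat.uavg_one_right]
    rfl
  exact ⟨fun j _ y _ => h1 j y, fun y _ => h1 k y, fun y _ x _ => h1 k x⟩

end Cond7374

/-! ## §2 The member: index (geometry + fixed background) and the `B8.LandauData` packaging -/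

section Member

/-- **The index of the Proposition-5 carriers**: lattice spacing `η > 0`, number of levels `k ≥ 1`, the domain sequence `{Ω_j}`
((1.3) p. 77) and the constraint sets `Λ_j` of the level-`k` problem in level-`j` coordinates ((1.5) p. 77, as read by (1.29)
`B8Eq119TwistedAxial.Restr129`), and the FIXED unitary background `U₀` of Sects. C–D (p. 89 «We fix a configuration U₀»).
[cite: Balaban1985RegularSpaces, (1.3)–(1.5) p.77, (1.29) p.81, p.89 (first sentence of Sect. D)] -/
structure ZdLanIdx (d : ℕ) (𝔸 : Type) [CStarAlgebra 𝔸] where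
  /-- lattice spacing -/
  η : ℝ
  hη : 0 < η
  /-- number of averaging levels (print's `k ≥ 1`) -/
  k : ℕ
  hk : 1 ≤ k
  /-- the domain sequence `Ω₀ ⊃ Ω₁ ⊃ … ⊃ Ω_k` (fine sites) -/
  Ω : ℕ → Set (Site d)
  /-- the constraint sets `Λ_j`, `j ≦ k`, level-`j` coordinates -/
  Λ : ℕ → Set (Site d)
  /-- the fixed background `U₀` -/
  U₀ : Site d → Fin d → 𝔸ˣ
  hU₀ : ∀ x κ, U₀ x κ ∈ unitaryUnits 𝔸

variable {𝔸 : Type} [CStarAlgebra 𝔸]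

/-- **THE `B8.LandauData` MEMBER OF THE GENERAL-BACKGROUND `ℤᵈ × 𝔸` FAMILY** (field-by-field reading in the module docstring):
Proposition 5's datum `(u₁, U₁ = e^{iηA})`, its hypotheses (1.33) ∧ (1.69) ∧ (1.68) ∧ (1.73)–(1.74) with the constant `B₁`, the
gauge parameters `λ` of `u′ = e^{iλ}` with the norm `max(|λ|, |Dλ|₍₋₁₎)` over `Ω_j`, `j ≦ k − 1`, and the equations (1.107).
[cite: Balaban1985RegularSpaces, Prop. 5 (1.107)–(1.109) p.94, (1.68)–(1.69) p.88, (1.73)–(1.74) pp.88–89, (1.102) p.93, (1.33) p.82] -/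
def zdLan (L : ℕ) (B₁ : ℝ) (i : ZdLanIdx d 𝔸) : B8.LandauData where
  Cfg := {p : (Site d → 𝔸ˣ) × (Site d → Fin d → 𝔸) // (∀ x, p.1 x ∈ unitaryUnits 𝔸) ∧ ∀ x κ, IsSelfAdjoint (p.2 x κ)}
  Lam := {lam : Site d → 𝔸 // (∀ x, IsSelfAdjoint (lam x)) ∧ (∀ x, x ∉ i.Ω 0 → lam x = 0) ∧
    ∃ C : ℝ, ∀ x, ‖lam x‖ ≤ C ∧ ∀ μ : Fin d, ‖covDerivFwd i.η i.U₀ μ lam x‖ ≤ C}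
  Hyp169 := fun α₀ α₁ p =>
    InAk L i.k i.η α₀ i.Ω i.U₀ ∧ Cond169 L i.k i.η i.Ω i.U₀ p.1.2 (B₁ * (α₀ + α₁)) ∧
      Cond168 L (i.k - 1) i.Λ i.U₀ p.1.1 ∧
        Cond7374 L i.k i.Λ i.U₀ p.1.1 (16 * d * B₁ * (α₀ + α₁)) (4 * d * B₁ * (α₀ + α₁))
  lamNorm := fun lam =>
    max (siteNorm L (i.k - 1) i.η 0 i.Ω lam.1)
      (bondNorm L (i.k - 1) i.η (-1) i.Ω (fun x μ => covDerivFwd i.η i.U₀ μ lam.1 x))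
  Solves := fun p lam =>
    IsLandau138W L i.k i.η (i.Ω 0) i.Λ i.U₀ (mgauge i.U₀ (gaugeExp lam.1)⁻¹ (cfgExp i.η p.1.2)) ∧
      Restr129 L i.k i.Λ i.U₀ (p.1.1 * gaugeExp lam.1)

variable (L : ℕ) (B₁ : ℝ) (i : ZdLanIdx d 𝔸)

/-- The hypothesis field read: `Hyp169 α₀ α₁ (u₁, A)` ⟺ (1.33) ∧ (1.69) ∧ (1.68) ∧ (1.73)–(1.74).
[cite: Balaban1985RegularSpaces, (1.68)–(1.69) p.88, (1.73)–(1.74) pp.88–89, (1.33) p.82] -/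
theorem zdLan_hyp169_iff (α₀ α₁ : ℝ) (p : (zdLan L B₁ i).Cfg) :
    (zdLan L B₁ i).Hyp169 α₀ α₁ p ↔
      InAk L i.k i.η α₀ i.Ω i.U₀ ∧ Cond169 L i.k i.η i.Ω i.U₀ p.1.2 (B₁ * (α₀ + α₁)) ∧
        Cond168 L (i.k - 1) i.Λ i.U₀ p.1.1 ∧
          Cond7374 L i.k i.Λ i.U₀ p.1.1 (16 * d * B₁ * (α₀ + α₁)) (4 * d * B₁ * (α₀ + α₁)) :=
  Iff.rfl

/-- The equations field read: `Solves (u₁, A) λ` ⟺ (1.107) — the Landau condition (1.38) for `U₁^{u′⁻¹} = (e^{iηA})^{(e^{iλ})⁻¹}`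
and (1.29) for `u′u₁`. [cite: Balaban1985RegularSpaces, (1.107) p.94, (1.38) p.82, (1.29) p.81] -/
theorem zdLan_solves_iff (p : (zdLan L B₁ i).Cfg) (lam : (zdLan L B₁ i).Lam) :
    (zdLan L B₁ i).Solves p lam ↔
      IsLandau138W L i.k i.η (i.Ω 0) i.Λ i.U₀ (mgauge i.U₀ (gaugeExp lam.1)⁻¹ (cfgExp i.η p.1.2)) ∧
        Restr129 L i.k i.Λ i.U₀ (p.1.1 * gaugeExp lam.1) :=
  Iff.rfl

/-- The norm field read: `lamNorm λ = max(|λ|, |D_{U₀}λ|₍₋₁₎)` over `Ω_j`, `j ≦ k − 1` ((1.102), p. 86 norms).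
[cite: Balaban1985RegularSpaces, (1.102) p.93, p.86 (definition after (1.55))] -/
theorem zdLan_lamNorm_eq (lam : (zdLan L B₁ i).Lam) :
    (zdLan L B₁ i).lamNorm lam =
      max (siteNorm L (i.k - 1) i.η 0 i.Ω lam.1)
        (bondNorm L (i.k - 1) i.η (-1) i.Ω (fun x μ => covDerivFwd i.η i.U₀ μ lam.1 x)) :=
  rfl

end Member

/-! ## §3 Kernel API: the base datum `u₁ = 1`, the trivial solution `λ = 0`, and the dictionary of the norm -/

section API

variable {𝔸 : Type} [CStarAlgebra 𝔸]
variable (L : ℕ) (B₁ : ℝ) (i : ZdLanIdx d 𝔸)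

/-- **p. 89: «They are satisfied in the case k = 1 also, if we take u₁ = 1, U′ = U₁»** — for the datum `(1, A)` the hypothesis
`Hyp169 α₀ α₁` of the member reduces to (1.33) for `U₀` and (1.69) for `A`: (1.68), (1.73), (1.74) hold for `u₁ = 1`
(`cond168_one'`, `cond7374_one`; constants non-negative for `B₁ ≥ 0`, `α₀ + α₁ ≥ 0`).
[cite: Balaban1985RegularSpaces, p.89 (sentence after (1.74)), (1.69) p.88] -/
theorem hyp169_one {α₀ α₁ : ℝ} (hB₁ : 0 ≤ B₁) (hα : 0 ≤ α₀ + α₁) (A : Site d → Fin d → 𝔸)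
    (hA : ∀ x κ, IsSelfAdjoint (A x κ)) (h33 : InAk L i.k i.η α₀ i.Ω i.U₀)
    (h69 : Cond169 L i.k i.η i.Ω i.U₀ A (B₁ * (α₀ + α₁))) :
    (zdLan L B₁ i).Hyp169 α₀ α₁ ⟨((1 : Site d → 𝔸ˣ), A), fun _ => Subgroup.one_mem _, hA⟩ := by
  refine ⟨h33, h69, cond168_one' L (i.k - 1) i.Λ i.U₀, ?_⟩
  have ha : (0 : ℝ) ≤ 16 * d * B₁ * (α₀ + α₁) := by positivity
  have hb : (0 : ℝ) ≤ 4 * d * B₁ * (α₀ + α₁) := by positivity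
  exact cond7374_one L i.k i.Λ i.U₀ ha hb

/-- `D^η_{U₀,μ} 0 = 0` (linearity of (1.1)). [cite: Balaban1985RegularSpaces, (1.1) p.76] -/
theorem covDerivFwd_zero_fun (η : ℝ) (U₀ : Site d → Fin d → 𝔸ˣ) (μ : Fin d) (x : Site d) :
    covDerivFwd η U₀ μ (0 : Site d → 𝔸) x = 0 := by
  simp [covDerivFwd, B7Eq78Linearization.conjR]

/-- **The zero gauge parameter** `λ = 0` as an element of the member's `Lam` (Hermitian, supported anywhere, bounded by `0`).
[cite: Balaban1985RegularSpaces, p.95 («a configuration identically equal to 1 is a solution also»)] -/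
def lamZero : (zdLan L B₁ i).Lam :=
  ⟨0, fun _ => by simp, fun _ _ => rfl, ⟨0, fun x => ⟨by simp, fun μ => by rw [covDerivFwd_zero_fun]; simp⟩⟩⟩

/-- The zero parameter's underlying function is `0` (`u′ = e^{i·0} = 1`, p. 95). [cite: Balaban1985RegularSpaces, p.95 («a configuration identically equal to 1 is a solution also»)] -/
@[simp] theorem lamZero_val : (lamZero L B₁ i).1 = 0 := rfl

/-- `e^{i·0} = 1`: the gauge transformation of the zero parameter is the identity. [cite: Balaban1985RegularSpaces, p.95] -/
theorem gaugeExp_zero' : gaugeExp (0 : Site d → 𝔸) = 1 := by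
  funext x
  ext
  simp [gaugeExp, expUnit]

/-- The moving-frame action (1.17) of the identity gauge transformation is the identity: `U₁^{1} = U₁`.
[cite: Balaban1985RegularSpaces, (1.17) p.78] -/
theorem mgauge_one_mid (U₀ W : Site d → Fin d → 𝔸ˣ) : mgauge U₀ (1 : Site d → 𝔸ˣ) W = W := by
  funext x κ
  simp [mgauge]

/-- **p. 95: «In the considered case a configuration identically equal to 1 is a solution also»** — the zero parameter solves
(1.107) for the datum `(u₁, U₁ = e^{iηA})` iff `U₁` itself satisfies the Landau condition (1.38) and `u₁` itself satisfies (1.29) at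
`k` levels (the situation of the uniqueness argument: `U₁` obeys (1.37)–(1.38), `u₁` obeys (1.29)_k).
[cite: Balaban1985RegularSpaces, p.95 (proof of the uniqueness clause of Thm 4), (1.107) p.94] -/
theorem solves_lamZero_iff (p : (zdLan L B₁ i).Cfg) :
    (zdLan L B₁ i).Solves p (lamZero L B₁ i) ↔
      IsLandau138W L i.k i.η (i.Ω 0) i.Λ i.U₀ (cfgExp i.η p.1.2) ∧ Restr129 L i.k i.Λ i.U₀ p.1.1 := by
  rw [zdLan_solves_iff, lamZero_val, gaugeExp_zero', inv_one, mgauge_one_mid, mul_one]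

/-- The zero parameter has norm `0`: `|0| = |D0|₍₋₁₎ = 0`. [cite: Balaban1985RegularSpaces, (1.108) p.94, p.86] -/
theorem lamNorm_lamZero : (zdLan L B₁ i).lamNorm (lamZero L B₁ i) = 0 := by
  rw [zdLan_lamNorm_eq, lamZero_val]
  have h1 : siteNorm L (i.k - 1) i.η 0 i.Ω (0 : Site d → 𝔸) = 0 := by
    simp [siteNorm, msup]
  have h2 : bondNorm L (i.k - 1) i.η (-1) i.Ω (fun x μ => covDerivFwd i.η i.U₀ μ (0 : Site d → 𝔸) x) = 0 := by
    have e : (fun x μ => covDerivFwd i.η i.U₀ μ (0 : Site d → 𝔸) x) = (0 : Site d → Fin d → 𝔸) := by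
      funext x μ; exact covDerivFwd_zero_fun i.η i.U₀ μ x
    rw [e, B8ScaledSupNorm.bondNorm_zero]
  rw [h1, h2, max_self]

/-- The member's parameters form bounded families for both p. 86 suprema (`|λ|` at weight `1`, `|Dλ|₍₋₁₎` at weight `Lʲη ≦ L^{k−1}η`),
so the real `iSup` of `B8ScaledSupNorm` is the printed supremum (`L ≥ 1`). [cite: Balaban1985RegularSpaces, p.86 (definition after (1.55))] -/
theorem bdd_of_lam (hL : 1 ≤ L) (lam : (zdLan L B₁ i).Lam) :
    Bdd L (i.k - 1) i.η 0 (fun j (x : Site d) => x ∈ i.Ω j) lam.1 ∧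
      Bdd L (i.k - 1) i.η (-1) (fun j (b : Site d × Fin d) => BondTouches (i.Ω j) b.1 b.2)
        (fun b => covDerivFwd i.η i.U₀ b.2 lam.1 b.1) := by
  obtain ⟨C, hC⟩ := lam.2.2.2
  have hC0 : 0 ≤ C := (norm_nonneg _).trans (hC 0).1
  refine ⟨⟨C, fun j _ x _ => ?_⟩, ⟨(L : ℝ) ^ (i.k - 1) * i.η * C, fun j hj b _ => ?_⟩⟩
  · rw [B8ScaledSupNorm.weight_zero, one_mul]
    exact (hC x).1
  · have ew : weight L i.η (-1) j = (L : ℝ) ^ j * i.η := by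
      have := B8ScaledSupNorm.weight_neg_natCast L i.η 1 j
      simpa using this
    rw [ew]
    have hLr : (1 : ℝ) ≤ L := by exact_mod_cast hL
    have hpow : (L : ℝ) ^ j ≤ (L : ℝ) ^ (i.k - 1) := pow_le_pow_right₀ hLr hj
    have hsc : (L : ℝ) ^ j * i.η ≤ (L : ℝ) ^ (i.k - 1) * i.η := mul_le_mul_of_nonneg_right hpow i.hη.le
    have hw0 : 0 ≤ (L : ℝ) ^ j * i.η := by have := i.hη.le; positivity
    calc (L : ℝ) ^ j * i.η * ‖covDerivFwd i.η i.U₀ b.2 lam.1 b.1‖ ≤ (L : ℝ) ^ j * i.η * C :=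
          mul_le_mul_of_nonneg_left ((hC b.1).2 b.2) hw0
      _ ≤ (L : ℝ) ^ (i.k - 1) * i.η * C := mul_le_mul_of_nonneg_right hsc hC0

/-- **DICTIONARY, (1.108)∕(1.109) ⇒ print's pointwise form** (p. 93 (1.102) «{λ : |λ| < βα₄, |Dλ| < βα₄(Lʲη)⁻¹ on Ω_j, j = 0, …, k − 1},
or simply {λ : |λ|, |Dλ|₍₋₁₎ < βα₄}»): `lamNorm λ < c` gives `‖λ(x)‖ < c` for `x ∈ Ω_j` and `(Lʲη)‖(D_{U₀}λ)(b)‖ < c` for the bonds `b` of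
`Ω_j`, every `j ≦ k − 1` (`L ≥ 1`). [cite: Balaban1985RegularSpaces, (1.102) p.93, (1.108)–(1.109) p.94] -/
theorem norm_lt_of_lamNorm_lt (hL : 1 ≤ L) (lam : (zdLan L B₁ i).Lam) {c : ℝ} (h : (zdLan L B₁ i).lamNorm lam < c)
    {j : ℕ} (hj : j ≤ i.k - 1) :
    (∀ x ∈ i.Ω j, ‖lam.1 x‖ < c) ∧
      ∀ (x : Site d) (μ : Fin d), BondTouches (i.Ω j) x μ → (L : ℝ) ^ j * i.η * ‖covDerivFwd i.η i.U₀ μ lam.1 x‖ < c := by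
  rw [zdLan_lamNorm_eq, max_lt_iff] at h
  obtain ⟨hB1, hB2⟩ := bdd_of_lam L B₁ i hL lam
  refine ⟨fun x hx => ?_, fun x μ hb => ?_⟩
  · have := B8ScaledSupNorm.norm_lt_of_msup_lt (mem := fun j (x : Site d) => x ∈ i.Ω j) hL i.hη hB1 h.1 hj (i := x) hx
    simpa using this
  · have h' := B8ScaledSupNorm.norm_lt_of_msup_lt (mem := fun j (b : Site d × Fin d) => BondTouches (i.Ω j) b.1 b.2)
      hL i.hη hB2 h.2 hj (i := (x, μ)) hb
    have hs : 0 < (L : ℝ) ^ j * i.η := B8ScaledSupNorm.scale_pos hL i.hη j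
    rw [Real.rpow_neg_one] at h'
    have := (lt_div_iff₀' hs).1 (by simpa [div_eq_mul_inv] using h')
    simpa [mul_assoc] using this

/-- **DICTIONARY, print's pointwise form ⇒ (1.108)**: non-strict pointwise bounds `‖λ‖ ≦ c′` on `Ω_j` and `(Lʲη)‖D_{U₀}λ‖ ≦ c′` on the bonds
of `Ω_j`, `j ≦ k − 1`, by a constant `0 ≦ c′ < c` give `lamNorm λ < c` (`L ≥ 1`) — the form in which the fixed-point providers
(`B8LeafModelZdOfHFP.SockHFP`: `‖lam‖ ≤ 8B₀′B₁(α₀+α₁)`, `(Lʲη)‖Dλ‖ ≤ …`) deliver (1.108). [cite: Balaban1985RegularSpaces, (1.108) p.94, (1.102) p.93] -/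
theorem lamNorm_lt_of_pointwise (hL : 1 ≤ L) (lam : (zdLan L B₁ i).Lam) {c c' : ℝ} (hc' : 0 ≤ c') (hcc : c' < c)
    (h1 : ∀ j ≤ i.k - 1, ∀ x ∈ i.Ω j, ‖lam.1 x‖ ≤ c')
    (h2 : ∀ j ≤ i.k - 1, ∀ (x : Site d) (μ : Fin d), BondTouches (i.Ω j) x μ →
      (L : ℝ) ^ j * i.η * ‖covDerivFwd i.η i.U₀ μ lam.1 x‖ ≤ c') :
    (zdLan L B₁ i).lamNorm lam < c := by
  rw [zdLan_lamNorm_eq, max_lt_iff]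
  constructor
  · have h := B8ScaledSupNorm.siteNorm_le_of_pointwise (lam := lam.1) (Ω := i.Ω) (k := i.k - 1) hL i.hη 0 hc'
      fun j hj x hx => by simpa using h1 j hj x hx
    have e : (-((0 : ℕ) : ℝ)) = 0 := by simp
    rw [e] at h
    exact lt_of_le_of_lt h hcc
  · refine lt_of_le_of_lt ?_ hcc
    have h := B8ScaledSupNorm.bondNorm_le_of_pointwise (Ω := i.Ω) (k := i.k - 1)
      (A := fun x μ => covDerivFwd i.η i.U₀ μ lam.1 x) hL i.hη 1 hc' fun j hj x μ hb => ?_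
    · simpa using h
    · have hs : 0 < (L : ℝ) ^ j * i.η := B8ScaledSupNorm.scale_pos hL i.hη j
      rw [pow_one, ← div_eq_mul_inv, le_div_iff₀' hs]
      exact h2 j hj x μ hb

/-- A parameter in the ball (1.109) lies in r05's typed domain **(1.77)** (`B8Eq178Averages.Cond177`, «|λ| < α₄, |(Dλ)(b)| < α₄(Lʲη)⁻¹
for b ∈ Ω_j, j = 0, …, k − 1») with `α₄ = c`: on `Ω_j` by the dictionary, and off `Ω₀` because the member's parameters vanish
there (`c > 0` as `c > lamNorm λ ≥ 0`). [cite: Balaban1985RegularSpaces, (1.77) p.90, (1.109) p.94] -/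
theorem cond177_of_lamNorm_lt (hL : 1 ≤ L) (lam : (zdLan L B₁ i).Lam) {c : ℝ}
    (h : (zdLan L B₁ i).lamNorm lam < c) : Cond177 L i.k i.η i.Ω i.U₀ lam.1 c := by
  have hc : 0 < c := by
    refine lt_of_le_of_lt ?_ h
    rw [zdLan_lamNorm_eq]
    exact le_max_of_le_left (B8ScaledSupNorm.msup_nonneg L (i.k - 1) i.hη.le 0 _ _)
  have hk : 0 ≤ i.k - 1 := Nat.zero_le _
  refine ⟨fun x => ?_, fun j hj x μ hb => ?_⟩
  · by_cases hx : x ∈ i.Ω 0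
    · exact (norm_lt_of_lamNorm_lt L B₁ i hL lam h hk).1 x hx
    · rw [lam.2.2.1 x hx, norm_zero]; exact hc
  · have hj' : j ≤ i.k - 1 := Nat.le_sub_one_of_lt hj
    have hs : 0 < (L : ℝ) ^ j * i.η := B8ScaledSupNorm.scale_pos hL i.hη j
    have := (norm_lt_of_lamNorm_lt L B₁ i hL lam h hj').2 x μ hb
    rw [lt_mul_inv_iff₀ hs]
    linarith [this]

end API

/-! ## §4 The knit's conjuncts p5e ∕ p5u AT THE MEMBER, displayed in tree vocabulary -/

section Display

variable {𝔸 : Type} [CStarAlgebra 𝔸]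
variable (L : ℕ) (B₀' B₁ : ℝ)

/-- **PROPOSITION 5, EXISTENCE CLAUSE (1.107)–(1.108), AT THE MEMBER** — the knit's `p5e : B8.Prop5Exists B₀′ B₁ lan` at
`lan := zdLan L B₁`, unfolded: «There exist positive constants c₂ … such that for an arbitrary configuration U₁ = e^{iηA} satisfying (1.69),
and for the configuration u₁ … satisfying (1.68), (1.73), (1.74), if α₀ + α₁ ≦ c₂, then there exists … u′ = e^{iλ} satisfying the
equations (1.107) and the bounds |λ|, |Dλ|₍₋₁₎ < 8B′₀B₁(α₀ + α₁) (1.108)» at every member (geometry, background `U₀ ∈ 𝔄_k({Ω_j}, α₀)`).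
A display (`Iff`), not an assertion. [cite: Balaban1985RegularSpaces, Prop. 5 (1.107)–(1.108) p.94] -/
theorem prop5Exists_zdLan_iff :
    B8.Prop5Exists B₀' B₁ (fun i : ZdLanIdx d 𝔸 => zdLan L B₁ i) ↔
      ∃ c₂ : ℝ, 0 < c₂ ∧ ∀ i : ZdLanIdx d 𝔸, ∀ α₀ α₁ : ℝ, 0 < α₀ → 0 < α₁ → α₀ + α₁ ≤ c₂ →
        ∀ p : (zdLan L B₁ i).Cfg,
          InAk L i.k i.η α₀ i.Ω i.U₀ → Cond169 L i.k i.η i.Ω i.U₀ p.1.2 (B₁ * (α₀ + α₁)) →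
            Cond168 L (i.k - 1) i.Λ i.U₀ p.1.1 →
              Cond7374 L i.k i.Λ i.U₀ p.1.1 (16 * d * B₁ * (α₀ + α₁)) (4 * d * B₁ * (α₀ + α₁)) →
                ∃ lam : (zdLan L B₁ i).Lam,
                  (IsLandau138W L i.k i.η (i.Ω 0) i.Λ i.U₀ (mgauge i.U₀ (gaugeExp lam.1)⁻¹ (cfgExp i.η p.1.2)) ∧
                      Restr129 L i.k i.Λ i.U₀ (p.1.1 * gaugeExp lam.1)) ∧
                    max (siteNorm L (i.k - 1) i.η 0 i.Ω lam.1)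
                        (bondNorm L (i.k - 1) i.η (-1) i.Ω (fun x μ => covDerivFwd i.η i.U₀ μ lam.1 x)) <
                      8 * B₀' * B₁ * (α₀ + α₁) := by
  unfold B8.Prop5Exists
  constructor
  · rintro ⟨c₂, hc₂, H⟩
    refine ⟨c₂, hc₂, fun i α₀ α₁ hα₀ hα₁ hs p h33 h69 h68 h7374 => ?_⟩
    exact H i α₀ α₁ hα₀ hα₁ hs p ⟨h33, h69, h68, h7374⟩
  · rintro ⟨c₂, hc₂, H⟩
    refine ⟨c₂, hc₂, fun i α₀ α₁ hα₀ hα₁ hs p hp => ?_⟩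
    exact H i α₀ α₁ hα₀ hα₁ hs p hp.1 hp.2.1 hp.2.2.1 hp.2.2.2

/-- **PROPOSITION 5, UNIQUENESS CLAUSE (1.109), AT THE MEMBER** — the knit's `p5u : B8.Prop5Unique lan` at `lan := zdLan L B₁`,
unfolded: «Such a configuration u′ is unique in the domain |λ|, |Dλ|₍₋₁₎ < c₃ (1.109)» — two parameters of the member solving (1.107)
for the same datum inside the ball of radius `c₃` coincide (as elements of the member's `Lam`, i.e. as functions on `ℤᵈ`).
A display (`Iff`), not an assertion. [cite: Balaban1985RegularSpaces, Prop. 5 (1.109) p.94] -/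
theorem prop5Unique_zdLan_iff :
    B8.Prop5Unique (fun i : ZdLanIdx d 𝔸 => zdLan L B₁ i) ↔
      ∃ c₂ c₃ : ℝ, 0 < c₂ ∧ 0 < c₃ ∧ ∀ i : ZdLanIdx d 𝔸, ∀ α₀ α₁ : ℝ, 0 < α₀ → 0 < α₁ → α₀ + α₁ ≤ c₂ →
        ∀ p : (zdLan L B₁ i).Cfg,
          InAk L i.k i.η α₀ i.Ω i.U₀ → Cond169 L i.k i.η i.Ω i.U₀ p.1.2 (B₁ * (α₀ + α₁)) →
            Cond168 L (i.k - 1) i.Λ i.U₀ p.1.1 →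
              Cond7374 L i.k i.Λ i.U₀ p.1.1 (16 * d * B₁ * (α₀ + α₁)) (4 * d * B₁ * (α₀ + α₁)) →
                ∀ l₁ l₂ : (zdLan L B₁ i).Lam,
                  (IsLandau138W L i.k i.η (i.Ω 0) i.Λ i.U₀ (mgauge i.U₀ (gaugeExp l₁.1)⁻¹ (cfgExp i.η p.1.2)) ∧
                      Restr129 L i.k i.Λ i.U₀ (p.1.1 * gaugeExp l₁.1)) →
                    (IsLandau138W L i.k i.η (i.Ω 0) i.Λ i.U₀ (mgauge i.U₀ (gaugeExp l₂.1)⁻¹ (cfgExp i.η p.1.2)) ∧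
                        Restr129 L i.k i.Λ i.U₀ (p.1.1 * gaugeExp l₂.1)) →
                      max (siteNorm L (i.k - 1) i.η 0 i.Ω l₁.1)
                          (bondNorm L (i.k - 1) i.η (-1) i.Ω (fun x μ => covDerivFwd i.η i.U₀ μ l₁.1 x)) < c₃ →
                        max (siteNorm L (i.k - 1) i.η 0 i.Ω l₂.1)
                            (bondNorm L (i.k - 1) i.η (-1) i.Ω (fun x μ => covDerivFwd i.η i.U₀ μ l₂.1 x)) < c₃ →
                          l₁.1 = l₂.1 := by
  unfold B8.Prop5Unique
  constructor
  · rintro ⟨c₂, c₃, hc₂, hc₃, H⟩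
    refine ⟨c₂, c₃, hc₂, hc₃, fun i α₀ α₁ hα₀ hα₁ hs p h33 h69 h68 h7374 l₁ l₂ hl₁ hl₂ hn₁ hn₂ => ?_⟩
    exact congrArg Subtype.val (H i α₀ α₁ hα₀ hα₁ hs p ⟨h33, h69, h68, h7374⟩ l₁ l₂ hl₁ hl₂ hn₁ hn₂)
  · rintro ⟨c₂, c₃, hc₂, hc₃, H⟩
    refine ⟨c₂, c₃, hc₂, hc₃, fun i α₀ α₁ hα₀ hα₁ hs p hp l₁ l₂ hl₁ hl₂ hn₁ hn₂ => ?_⟩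
    exact Subtype.ext (H i α₀ α₁ hα₀ hα₁ hs p hp.1 hp.2.1 hp.2.2.1 hp.2.2.2 l₁ l₂ hl₁ hl₂ hn₁ hn₂)

end Display

#print axioms cond7374_one
#print axioms cond168_one'
#print axioms hyp169_one
#print axioms solves_lamZero_iff
#print axioms lamNorm_lamZero
#print axioms norm_lt_of_lamNorm_lt
#print axioms lamNorm_lt_of_pointwise
#print axioms cond177_of_lamNorm_lt
#print axioms prop5Exists_zdLan_iff
#print axioms prop5Unique_zdLan_iff

end Literature.MathematicalPhysics.QuantumFieldTheory.Balaban1983to89.B8Prop5LandauDataZd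

end
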